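import Literature.MathematicalPhysics.QuantumFieldTheory.BalabanImbrieJaffe1984to88.BIJ85Eq5113Proof
import Literature.MathematicalPhysics.QuantumFieldTheory.BalabanImbrieJaffe1984to88.BIJ85Eq219ProofPart2

/-!
# `BalabanImbrieJaffe1984to88.BIJ85GaugeFnBound513` — T. Bałaban, J. Imbrie, A. Jaffe, *Renormalization of the Higgs model:
minimizers, propagators and the stability of mean field theory*, Commun. Math. Phys. **97** (1985) 299–329 [BalabanImbrieJaffe1985]:
p. 326, first sentence of (7.2.4) — *"The gauge transformation λ in (5.1.1) is bounded"* — and the LOCALITY of the gauge function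
`λ(A)` of (5.1.13) behind the kernel bound (7.2.4): PROVED on the V1 lattice calculus for the concrete `λ(A)` =
`…BIJ85GaugeFunction5113.lamOf` (file 1 of 2 of row C1.Eq7.2.4; file 2 = `…BIJ85Ineq724Proof`, the kernel `D_k` and its decay)

statement-level skeleton of published theorems with citation tags; proofs where landed; nothing here is a claim about the Yang–Mills mass gap

PDF held: `paper:balaban1985-cmp97-bij-higgs-minimizers` (journal page = PDF page + 298); p. 326 [PDF 28] read as an image
(`run/shared/lean/pub/lit-balaban/lit-balaban-r15/pages/1985-cmp97-bij-higgs-minimizers-p028-x2.png`), pp. 314–315 [PDF 16–17]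
(`…/lit-balaban-p08/renders/bij85-p016.png`, `…p017.png`).

THE PRINTED TEXT (p. 326, verbatim): *"The gauge transformation λ in (5.1.1) is bounded and depends on B through an exponentially
decaying kernel D_k: λ(x) = (D_kB)(x), |D_k(x, b)| ≤ Me^{−δdist(x,b)}. (7.2.4) This estimate follows from (5.1.4) and (7.2.2)."*
Here λ = λ(H_kB) is (5.1.4) = (5.1.13) at `A = H_kB`:  *"λ(x) = λ(A, x) = −Σ_{j=0}^{k−1} L^{j−k}[(Q_jA)(Γ_{x_{j+1},x_j}) −
Q′(Q_jA)(Γ_{x_{j+1},·})]. (5.1.13)"* (p. 315).  WHY (7.2.4) follows from (5.1.4): every term of (5.1.13) at the point `x` reads the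
averages `Q_jA` only along staircase contours INSIDE the block `B(x_{j+1}) ⊂ B^k(x_k)`, i.e. `λ(A)(x)` sees `A` only on the η-bonds of
the unit block `B^k(x_k) ∋ x` (LOCALITY), and it is a finite combination of at most `2·d·(L−1)/2` averages of `A` per scale with the
weights `L^{j−k}`, `Σ_{j<k} L^{j−k} < (L−1)^{−1}` (BOUNDEDNESS: `|λ(A)(x)| ≤ d·sup_b|A(b)|` at the printed normalisation).

CITATION HEADER (lean-in-tree rule).  Phase-2 file of the lit-balaban TYPED SKELETON (HOME `run/shared/lean/pub/lit-balaban/`), SKELETON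
row **`C1.Eq7.2.4`** (reader r15 `ROWS-C1`: `typed p239582`, decl `…BIJ85Sect7Statements.KernelData.Ineq724`), seat p08 gen 3 (unit
`lit-balaban-p08`; TAKING HOME/STATUS.md 2026-08-21T04:18:37Z).  WHAT IS PROVED HERE, over the carriers OF RECORD of
`…Balaban1983to89.LatticeFieldCalculus` (tori `Setup.Site P j`, `VecField`/`SiteField`, `Q_j` = `bondAvgIter j`, `Q′` = `siteAvg`, staircase
contours `Γ_{y,x}` = `stairSum`, CENTRED blocks `Site.blockSite`/`blockOf`/`emb` — DIVERGENCE F3 of `pub-balaban` inherited) and the objects of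
`…BIJ85GaugeFunction5113` (`blk j x = x_j`, `contour`, `blockMean`, `fluct`, `lamOf c k A = λ(A)` with the lattice factor `c` of `∂` explicit,
`c = η⁻¹ = L^k` in print), in the standing range `k ≤ m + K`:
* §1 — SUP BOUNDS (the averages are convex combinations; a staircase inside a block has at most `(L−1)/2` bonds per direction):
  `norm_runSum_le`, `valMinAbs_blockSite_sub_emb`/`natAbs_valMinAbs_blockSite_sub_emb_le` (|n_μ| ≤ (L−1)/2), `norm_stairSum_le`, `norm_siteAvg_le`, `norm_bondAvg_le`,
  `norm_bondAvgIter_le`, `norm_contour_le`, `norm_blockMean_le`, `norm_fluct_le`;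
* §2 — **"λ is bounded"**: `norm_lamOf_le` (`‖λ(A)(x)‖ ≤ (2·d·((L−1)/2)·Σ_{j<k}L^j/|c|)·sup‖A‖`) and, at the printed normalisation
  `c = L^k`, `norm_lamOf_le_unit` (`‖λ(A)(x)‖ ≤ d·(1 − L^{−k})·sup‖A‖ ≤ d·sup‖A‖`);
* §3 — LOCALITY: `bondAvgIter_eq_zero_of_vanish` (if `A` vanishes on the η-bonds with both endpoints over a set `S` of `T^{(n)}`-sites,
  `Q_nA` vanishes on the `T^{(n)}`-bonds with both endpoints in `S` — from the block geometry of the straight contours of (2.13),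
  `…BIJ85Eq219Proof.blockOf_runSite_blockSite_of_lt/ge`), **`lamOf_eq_zero_of_vanish`** (if `A` vanishes on the η-bonds of the unit
  block `B^k(y)` then `λ(A) = 0` on `B^k(y)` — from `…BIJ85Eq219ProofPart2.stairSum_eq_zero_of_interior`: the staircase `Γ_{x_{j+1},x′}`,
  `x′ ∈ B(x_{j+1})`, has both endpoints of every bond in `B(x_{j+1})`), and `lamOf_congr_tower` (`λ(A)(x)` depends on `A↾B^k(x_k)` only).
Theorems only (no definition, no Prop-valued fact); nothing of the paper is asserted beyond these kernel-checked bounds.  (7.2.2) itself (decay of `H_k`, *"a consequence of Proposition 1.2 and the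
representation (1.103) of [6I]"*) is NOT proved anywhere in the tree and enters file 2 as a displayed hypothesis.
-/

namespace Literature.MathematicalPhysics.QuantumFieldTheory.BalabanImbrieJaffe1984to88.BIJ85GaugeFnBound513

open Literature.MathematicalPhysics.QuantumFieldTheory.Balaban1983to89
open LatticeFieldCalculus B5Eq120IterProof BIJ85AxialPropagator411 BIJ85GaugeFunction5113 BIJ85Eq5113Proof
open BIJ85Eq219Proof BIJ85Eq219ProofPart2

/-! ## §1  Sup bounds: averages are convex combinations; a staircase in a block has `≤ (L−1)/2` bonds per direction -/

section SupBounds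

variable {P : Params} {j : ℕ} {V : Type*} [NormedAddCommGroup V] [NormedSpace ℝ V]

omit [NormedSpace ℝ V] in
/-- A bound valid at every bond is nonnegative (the bond set of a torus is nonempty: `d ≥ 1`). [folklore] -/
private theorem nonneg_of_bound {A : VecField P j V} {a : ℝ} (hA : ∀ b, ‖A b‖ ≤ a) : 0 ≤ a :=
  (norm_nonneg _).trans (hA ⟨default, ⟨0, P.hd⟩⟩)

omit [NormedSpace ℝ V] in
/-- `‖A(run of n steps)‖ ≤ |n|·sup‖A‖`: the signed straight-run sum of [Balaban1984PropagatorsI] (1.7) has `|n|` bonds.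
[cite: Balaban1984PropagatorsI, (1.7) p.18] -/
theorem norm_runSum_le (A : VecField P j V) {a : ℝ} (hA : ∀ b, ‖A b‖ ≤ a) (x : Site P j) (μ : Fin P.d) (n : ℤ) :
    ‖runSum A x μ n‖ ≤ |(n : ℝ)| * a := by
  cases n with
  | ofNat n =>
    simp only [runSum, Int.ofNat_eq_natCast, Int.cast_natCast, Nat.abs_cast]
    calc ‖∑ t ∈ Finset.range n, A ⟨runSite x μ t, μ⟩‖ ≤ ∑ t ∈ Finset.range n, ‖A ⟨runSite x μ t, μ⟩‖ := norm_sum_le _ _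
      _ ≤ ∑ _t ∈ Finset.range n, a := Finset.sum_le_sum fun t _ => hA _
      _ = n * a := by rw [Finset.sum_const, Finset.card_range, nsmul_eq_mul]
  | negSucc n =>
    simp only [runSum, norm_neg, Int.cast_negSucc, abs_neg]
    have hn : |((n : ℝ) + 1)| = n + 1 := abs_of_nonneg (by positivity)
    rw [show ((n + 1 : ℕ) : ℝ) = (n : ℝ) + 1 by push_cast; ring, hn]
    calc ‖∑ t ∈ Finset.range (n + 1), A ⟨Function.update x μ (x μ - (t + 1 : ℕ)), μ⟩‖
        ≤ ∑ t ∈ Finset.range (n + 1), ‖A ⟨Function.update x μ (x μ - (t + 1 : ℕ)), μ⟩‖ := norm_sum_le _ _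
      _ ≤ ∑ _t ∈ Finset.range (n + 1), a := Finset.sum_le_sum fun t _ => hA _
      _ = ((n : ℝ) + 1) * a := by rw [Finset.sum_const, Finset.card_range, nsmul_eq_mul]; push_cast; ring

/-- The centred offset of a block site from the block centre, read by `ZMod.valMinAbs` as `stairSum` does, is the printed
`n_μ = r_μ − (L−1)/2` (cf. (5.1.2)–(5.1.3): `x ∈ B(x_1)`; standing range, `N_j = L·N_{j+1} > 2|n_μ|`). [cite: Balaban1984PropagatorsI, (1.7) p.18] -/
theorem valMinAbs_blockSite_sub_emb (hj : j + 1 ≤ P.m + P.K) (y : Site P (j + 1)) (r : Fin P.d → Fin P.L) (μ : Fin P.d) :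
    (Site.blockSite y r μ - emb y μ).valMinAbs = (r μ : ℤ) - (((P.L - 1) / 2 : ℕ) : ℤ) := by
  apply (ZMod.valMinAbs_spec _ _).mpr
  have hL := AveragingRT.two_mul_half_add_one P
  have hN : P.L ≤ P.sitesPerDir j := by
    rw [P.sitesPerDir_eq_mul_succ hj]
    exact Nat.le_mul_of_pos_left P.L (Nat.pos_of_ne_zero (P.sitesPerDir_ne_zero (j + 1)))
  have hr := (r μ).isLt
  refine ⟨?_, ?_⟩
  · simp only [Site.blockSite, emb, Nat.cast_add, Nat.cast_mul, Int.cast_sub, Int.cast_natCast]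
    ring
  · simp only [Set.mem_Ioc]
    have hN' : ((P.L : ℕ) : ℤ) ≤ ((P.sitesPerDir j : ℕ) : ℤ) := by exact_mod_cast hN
    constructor <;> push_cast <;> omega

/-- `|n_μ| ≤ (L−1)/2`: the staircase `Γ_{y,x}`, `x ∈ B(y)`, runs at most `(L−1)/2` bonds in each direction (centred blocks).
[cite: Balaban1984PropagatorsI, (1.7) p.18] -/
theorem natAbs_valMinAbs_blockSite_sub_emb_le (hj : j + 1 ≤ P.m + P.K) (y : Site P (j + 1)) (r : Fin P.d → Fin P.L)
    (μ : Fin P.d) : ((Site.blockSite y r μ - emb y μ).valMinAbs).natAbs ≤ (P.L - 1) / 2 := by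
  rw [valMinAbs_blockSite_sub_emb hj]
  have hr := (r μ).isLt
  have hL := AveragingRT.two_mul_half_add_one P
  omega

omit [NormedSpace ℝ V] in
/-- **A staircase inside a block is short**: `‖A(Γ_{y,x})‖ ≤ d·((L−1)/2)·sup‖A‖` for `x ∈ B(y)` (standing range).
[cite: BalabanImbrieJaffe1985, (5.1.3) p.314] -/
theorem norm_stairSum_le (hj : j + 1 ≤ P.m + P.K) (A : VecField P j V) {a : ℝ} (hA : ∀ b, ‖A b‖ ≤ a)
    (y : Site P (j + 1)) (r : Fin P.d → Fin P.L) :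
    ‖stairSum A (emb y) (Site.blockSite y r)‖ ≤ ((P.d * ((P.L - 1) / 2) : ℕ) : ℝ) * a := by
  have ha := nonneg_of_bound hA
  unfold stairSum
  calc ‖∑ μ : Fin P.d, runSum A (mixSite μ (emb y) (Site.blockSite y r)) μ (Site.blockSite y r μ - emb y μ).valMinAbs‖
      ≤ ∑ μ : Fin P.d, ‖runSum A (mixSite μ (emb y) (Site.blockSite y r)) μ (Site.blockSite y r μ - emb y μ).valMinAbs‖ :=
        norm_sum_le _ _
    _ ≤ ∑ _μ : Fin P.d, (((P.L - 1) / 2 : ℕ) : ℝ) * a := by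
        refine Finset.sum_le_sum fun μ _ => ?_
        set n : ℤ := (Site.blockSite y r μ - emb y μ).valMinAbs with hn
        have h : n.natAbs ≤ (P.L - 1) / 2 := natAbs_valMinAbs_blockSite_sub_emb_le hj y r μ
        have hcast : |((n : ℤ) : ℝ)| ≤ (((P.L - 1) / 2 : ℕ) : ℝ) := by
          have h' : (n.natAbs : ℝ) ≤ (((P.L - 1) / 2 : ℕ) : ℝ) := by exact_mod_cast h
          simpa [Nat.cast_natAbs] using h'
        exact (norm_runSum_le A hA _ μ n).trans (mul_le_mul_of_nonneg_right hcast ha)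
    _ = ((P.d * ((P.L - 1) / 2) : ℕ) : ℝ) * a := by
        rw [Finset.sum_const, Finset.card_univ, Fintype.card_fin, nsmul_eq_mul]; push_cast; ring

/-- **`Q′` is a convex combination**: `‖(Q′f)(y)‖ ≤ sup‖f‖`. [cite: Balaban1984PropagatorsI, (1.13) p.19] -/
theorem norm_siteAvg_le {W : Type*} [NormedAddCommGroup W] [NormedSpace ℝ W] (f : SiteField P j W) {a : ℝ}
    (hf : ∀ x, ‖f x‖ ≤ a) (y : Site P (j + 1)) : ‖siteAvg f y‖ ≤ a := by
  have hL : (0 : ℝ) < (P.L : ℝ) ^ P.d := pow_pos (Nat.cast_pos.mpr P.L_pos) _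
  unfold siteAvg
  rw [norm_smul, norm_inv, Real.norm_eq_abs, abs_of_pos hL]
  calc ((P.L : ℝ) ^ P.d)⁻¹ * ‖∑ r : Fin P.d → Fin P.L, f (Site.blockSite y r)‖
      ≤ ((P.L : ℝ) ^ P.d)⁻¹ * ∑ r : Fin P.d → Fin P.L, ‖f (Site.blockSite y r)‖ :=
        mul_le_mul_of_nonneg_left (norm_sum_le _ _) (inv_nonneg.mpr hL.le)
    _ ≤ ((P.L : ℝ) ^ P.d)⁻¹ * ∑ _r : Fin P.d → Fin P.L, a :=
        mul_le_mul_of_nonneg_left (Finset.sum_le_sum fun r _ => hf _) (inv_nonneg.mpr hL.le)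
    _ = a := by
        rw [Finset.sum_const, Finset.card_univ, Fintype.card_fun, Fintype.card_fin, Fintype.card_fin, nsmul_eq_mul]
        push_cast
        field_simp

omit [NormedSpace ℝ V] in
/-- `‖A([x, x + n e_μ])‖ ≤ n·sup‖A‖`. [cite: Balaban1984PropagatorsI, (1.8) p.19] -/
theorem norm_segSum_le (A : VecField P j V) {a : ℝ} (hA : ∀ b, ‖A b‖ ≤ a) (x : Site P j) (μ : Fin P.d) (n : ℕ) :
    ‖segSum A x μ n‖ ≤ n * a := by
  unfold segSum
  calc ‖∑ t ∈ Finset.range n, A (runBond x μ t)‖ ≤ ∑ t ∈ Finset.range n, ‖A (runBond x μ t)‖ := norm_sum_le _ _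
    _ ≤ ∑ _t ∈ Finset.range n, a := Finset.sum_le_sum fun t _ => hA _
    _ = n * a := by rw [Finset.sum_const, Finset.card_range, nsmul_eq_mul]

/-- **`Q` is a convex combination**: `‖(QA)(c)‖ ≤ sup‖A‖` (`L^d·L` bonds, weights `L^{−(d+1)}`). [cite: Balaban1984PropagatorsI, (1.11) p.19] -/
theorem norm_bondAvg_le (A : VecField P j V) {a : ℝ} (hA : ∀ b, ‖A b‖ ≤ a) (c : PBond P (j + 1)) :
    ‖bondAvg A c‖ ≤ a := by
  have hL0 : (0 : ℝ) < (P.L : ℝ) := Nat.cast_pos.mpr P.L_pos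
  have hL : (0 : ℝ) < (P.L : ℝ) ^ (P.d + 1) := pow_pos hL0 _
  unfold bondAvg
  rw [norm_smul, norm_inv, Real.norm_eq_abs, abs_of_pos hL]
  calc ((P.L : ℝ) ^ (P.d + 1))⁻¹ * ‖∑ r : Fin P.d → Fin P.L, segSum A (Site.blockSite c.src r) c.dir P.L‖
      ≤ ((P.L : ℝ) ^ (P.d + 1))⁻¹ * ∑ r : Fin P.d → Fin P.L, ‖segSum A (Site.blockSite c.src r) c.dir P.L‖ :=
        mul_le_mul_of_nonneg_left (norm_sum_le _ _) (inv_nonneg.mpr hL.le)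
    _ ≤ ((P.L : ℝ) ^ (P.d + 1))⁻¹ * ∑ _r : Fin P.d → Fin P.L, (P.L : ℝ) * a :=
        mul_le_mul_of_nonneg_left (Finset.sum_le_sum fun r _ => norm_segSum_le A hA _ _ _) (inv_nonneg.mpr hL.le)
    _ = a := by
        rw [Finset.sum_const, Finset.card_univ, Fintype.card_fun, Fintype.card_fin, Fintype.card_fin, nsmul_eq_mul]
        push_cast
        field_simp
        ring

/-- **`Q_n` is a convex combination**: `‖(Q_nA)(b)‖ ≤ sup‖A‖`. [cite: Balaban1984PropagatorsI, (1.18) p.20] -/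
theorem norm_bondAvgIter_le : ∀ (n : ℕ) (A : VecField P 0 V) {a : ℝ}, (∀ b, ‖A b‖ ≤ a) → ∀ b, ‖bondAvgIter n A b‖ ≤ a
  | 0, _, _, hA, b => hA b
  | n + 1, A, _, hA, b => by
    rw [bondAvgIter_succ]
    exact norm_bondAvg_le _ (norm_bondAvgIter_le n A hA) b

omit [NormedSpace ℝ V] in
/-- `‖A(Γ_{z₊,z})‖ ≤ d·((L−1)/2)·sup‖A‖` — the contour functional of (5.1.4)/(5.1.10) (standing range).
[cite: BalabanImbrieJaffe1985, (5.1.10) p.315] -/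
theorem norm_contour_le (hj : j + 1 ≤ P.m + P.K) (A : VecField P j V) {a : ℝ} (hA : ∀ b, ‖A b‖ ≤ a) (z : Site P j) :
    ‖contour A z‖ ≤ ((P.d * ((P.L - 1) / 2) : ℕ) : ℝ) * a := by
  obtain ⟨r, hr⟩ := exists_blockSite_eq hj z
  unfold contour
  rw [← hr, Site.blockOf_blockSite hj]
  exact norm_stairSum_le hj A hA _ r

/-- `‖Q′(A(Γ_{y,·}))(y)‖ ≤ d·((L−1)/2)·sup‖A‖` — the block mean of (5.1.11). [cite: BalabanImbrieJaffe1985, (5.1.11) p.315] -/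
theorem norm_blockMean_le (hj : j + 1 ≤ P.m + P.K) (A : VecField P j V) {a : ℝ} (hA : ∀ b, ‖A b‖ ≤ a) (y : Site P (j + 1)) :
    ‖blockMean A y‖ ≤ ((P.d * ((P.L - 1) / 2) : ℕ) : ℝ) * a :=
  norm_siteAvg_le _ (norm_contour_le hj A hA) y

/-- `‖(Q_jA)(Γ_{x_{j+1},x_j}) − Q′(Q_jA)(Γ_{x_{j+1},·})‖ ≤ 2·d·((L−1)/2)·sup‖A‖` — the bracket of (5.1.12)/(5.1.13).
[cite: BalabanImbrieJaffe1985, (5.1.12) p.315] -/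
theorem norm_fluct_le (hj : j + 1 ≤ P.m + P.K) (A : VecField P j V) {a : ℝ} (hA : ∀ b, ‖A b‖ ≤ a) (z : Site P j) :
    ‖fluct A z‖ ≤ 2 * ((P.d * ((P.L - 1) / 2) : ℕ) : ℝ) * a := by
  unfold fluct
  calc ‖contour A z - blockMean A (blockOf z)‖ ≤ ‖contour A z‖ + ‖blockMean A (blockOf z)‖ := norm_sub_le _ _
    _ ≤ ((P.d * ((P.L - 1) / 2) : ℕ) : ℝ) * a + ((P.d * ((P.L - 1) / 2) : ℕ) : ℝ) * a := add_le_add (norm_contour_le hj A hA z) (norm_blockMean_le hj A hA _)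
    _ = 2 * ((P.d * ((P.L - 1) / 2) : ℕ) : ℝ) * a := by ring

end SupBounds

/-! ## §2  *"The gauge transformation λ in (5.1.1) is bounded"* (p. 326) -/

section Bounded

variable {P : Params} {V : Type*} [NormedAddCommGroup V] [NormedSpace ℝ V]

/-- The constant of the sup bound of `λ(A)` is nonnegative. [cite: BalabanImbrieJaffe1985, (7.2.4) p.326] -/
theorem lamBound_nonneg (P : Params) (k : ℕ) (c : ℝ) :
    0 ≤ 2 * ((P.d * ((P.L - 1) / 2) : ℕ) : ℝ) * (∑ j ∈ Finset.range k, (P.L : ℝ) ^ j) / |c| := by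
  have : 0 ≤ ∑ j ∈ Finset.range k, (P.L : ℝ) ^ j := Finset.sum_nonneg fun j _ => by positivity
  positivity

/-- **"λ is bounded"** (p. 326, first clause of (7.2.4)): for every η-lattice bond field `A` with `‖A(b)‖ ≤ a` for all bonds and
every point `x`, `‖λ(A)(x)‖ ≤ (2·d·((L−1)/2)·Σ_{j<k}L^j/|c|)·a` — from (5.1.13): `k` scales, weight `L^j/|c|` at scale `j`, and the
bracket bounded by `norm_fluct_le` since `‖Q_jA‖ ≤ a` (standing range `k ≤ m + K`).
[cite: BalabanImbrieJaffe1985, (7.2.4) p.326] -/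
theorem norm_lamOf_le {k : ℕ} (hk : k ≤ P.m + P.K) (c : ℝ) (A : VecField P 0 V) {a : ℝ} (hA : ∀ b, ‖A b‖ ≤ a)
    (x : Site P 0) :
    ‖lamOf c k A x‖ ≤ (2 * ((P.d * ((P.L - 1) / 2) : ℕ) : ℝ) * (∑ j ∈ Finset.range k, (P.L : ℝ) ^ j) / |c|) * a := by
  have ha := nonneg_of_bound hA
  rw [lamOf_apply, norm_neg]
  calc ‖∑ j ∈ Finset.range k, ((P.L : ℝ) ^ j / c) • fluct (bondAvgIter j A) (blk j x)‖
      ≤ ∑ j ∈ Finset.range k, ‖((P.L : ℝ) ^ j / c) • fluct (bondAvgIter j A) (blk j x)‖ := norm_sum_le _ _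
    _ ≤ ∑ j ∈ Finset.range k, ((P.L : ℝ) ^ j / |c|) * (2 * ((P.d * ((P.L - 1) / 2) : ℕ) : ℝ) * a) := by
        refine Finset.sum_le_sum fun j hj => ?_
        have hj' : j + 1 ≤ P.m + P.K := by have := Finset.mem_range.mp hj; omega
        rw [norm_smul, Real.norm_eq_abs, abs_div, abs_of_nonneg (by positivity : (0 : ℝ) ≤ (P.L : ℝ) ^ j)]
        exact mul_le_mul_of_nonneg_left (norm_fluct_le hj' _ (norm_bondAvgIter_le j A hA) _) (by positivity)
    _ = (2 * ((P.d * ((P.L - 1) / 2) : ℕ) : ℝ) * (∑ j ∈ Finset.range k, (P.L : ℝ) ^ j) / |c|) * a := by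
        rw [← Finset.sum_mul, ← Finset.sum_div]
        ring

/-- `(L−1)·Σ_{j<k} L^j = L^k − 1`. [folklore] -/
private theorem geom_sum_L (L : ℝ) (k : ℕ) : (L - 1) * ∑ j ∈ Finset.range k, L ^ j = L ^ k - 1 := by
  rw [mul_comm, geom_sum_mul]

/-- At the PRINTED normalisation `c = η⁻¹ = L^k` the constant is `d·(1 − L^{−k})`: `2·((L−1)/2) = L − 1` (L odd) and
`(L−1)Σ_{j<k}L^j = L^k − 1`. [cite: BalabanImbrieJaffe1985, (7.2.4) p.326] -/
theorem lamBound_unit (P : Params) (k : ℕ) :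
    2 * ((P.d * ((P.L - 1) / 2) : ℕ) : ℝ) * (∑ j ∈ Finset.range k, (P.L : ℝ) ^ j) / |(P.L : ℝ) ^ k|
      = P.d * (1 - ((P.L : ℝ) ^ k)⁻¹) := by
  have hL0 : (0 : ℝ) < (P.L : ℝ) := Nat.cast_pos.mpr P.L_pos
  have hLk : (0 : ℝ) < (P.L : ℝ) ^ k := pow_pos hL0 _
  have hodd : (2 : ℝ) * (((P.L - 1) / 2 : ℕ) : ℝ) = (P.L : ℝ) - 1 := by
    have h := AveragingRT.two_mul_half_add_one P
    have h' : ((2 * ((P.L - 1) / 2) + 1 : ℕ) : ℝ) = (P.L : ℝ) := by exact_mod_cast h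
    push_cast at h'
    linarith
  rw [abs_of_pos hLk]
  push_cast
  rw [show (2 : ℝ) * ((P.d : ℝ) * (((P.L - 1) / 2 : ℕ) : ℝ)) = (P.d : ℝ) * ((2 : ℝ) * (((P.L - 1) / 2 : ℕ) : ℝ)) by ring, hodd,
    mul_assoc, geom_sum_L]
  field_simp

/-- **"λ is bounded", printed normalisation**: `‖λ(A)(x)‖ ≤ d·(1 − L^{−k})·sup‖A‖` (`c = L^k`, standing range).
[cite: BalabanImbrieJaffe1985, (7.2.4) p.326] -/
theorem norm_lamOf_le_unit {k : ℕ} (hk : k ≤ P.m + P.K) (A : VecField P 0 V) {a : ℝ} (hA : ∀ b, ‖A b‖ ≤ a) (x : Site P 0) :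
    ‖lamOf ((P.L : ℝ) ^ k) k A x‖ ≤ P.d * (1 - ((P.L : ℝ) ^ k)⁻¹) * a := by
  rw [← lamBound_unit]; exact norm_lamOf_le hk _ A hA x

/-- … hence `‖λ(A)(x)‖ ≤ d·sup‖A‖`, uniformly in `k` and in the volume. [cite: BalabanImbrieJaffe1985, (7.2.4) p.326] -/
theorem norm_lamOf_le_unit' {k : ℕ} (hk : k ≤ P.m + P.K) (A : VecField P 0 V) {a : ℝ} (hA : ∀ b, ‖A b‖ ≤ a) (x : Site P 0) :
    ‖lamOf ((P.L : ℝ) ^ k) k A x‖ ≤ P.d * a := by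
  have ha := nonneg_of_bound hA
  refine (norm_lamOf_le_unit hk A hA x).trans ?_
  have hLk : (0 : ℝ) < ((P.L : ℝ) ^ k)⁻¹ := inv_pos.mpr (pow_pos (Nat.cast_pos.mpr P.L_pos) _)
  have hd : (0 : ℝ) ≤ (P.d : ℝ) := Nat.cast_nonneg _
  have h3 : (0 : ℝ) ≤ (P.d : ℝ) * a * ((P.L : ℝ) ^ k)⁻¹ := by positivity
  have h4 : (P.d : ℝ) * (1 - ((P.L : ℝ) ^ k)⁻¹) * a = P.d * a - P.d * a * ((P.L : ℝ) ^ k)⁻¹ := by ring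
  rw [h4]
  linarith

end Bounded

/-! ## §3  Locality: `λ(A)(x)` only sees `A` on the η-bonds of the unit block `B^k(x_k) ∋ x` -/

section Locality

variable {P : Params} {V : Type*} [AddCommGroup V] [Module ℝ V]

/-- `x_{n+1} = (x_n)_1`: the point sequence (5.1.2) read from the bottom, `blk (n+1) x = blockOf (blk n x)`.
[cite: BalabanImbrieJaffe1985, (5.1.2)–(5.1.3) p.313] -/
theorem blk_succ (n : ℕ) (x : Site P 0) : blk (n + 1) x = blockOf (blk n x) := rfl

/-- **The straight contours of the averages stay over their coarse bond**: if an η-lattice bond field `A` vanishes on every bond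
whose two endpoints have their `n`-th block points in a set `S ⊆ T^{(n)}`, then `Q_nA` vanishes on every `T^{(n)}`-bond with both
endpoints in `S` — the fine bonds of `(Q_nA)(b′)` ((1.18)/(2.13): `x ∈ B^n(b′₋)`, contour `[x, x(b′)]`) run inside `B^n(b′₋) ∪ B^n(b′₊)`
(standing range `n ≤ m + K`). [cite: Balaban1984PropagatorsI, (1.18) p.20] -/
theorem bondAvgIter_eq_zero_of_vanish :
    ∀ (n : ℕ), n ≤ P.m + P.K → ∀ (S : Set (Site P n)) (A : VecField P 0 V),
      (∀ b : PBond P 0, blk n b.src ∈ S → blk n b.tgt ∈ S → A b = 0) →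
        ∀ b' : PBond P n, b'.src ∈ S → b'.tgt ∈ S → bondAvgIter n A b' = 0
  | 0, _, S, A, hA, b', hs, ht => by rw [bondAvgIter_zero]; exact hA b' hs ht
  | n + 1, hn, S, A, hA, b', hs, ht => by
    rw [bondAvgIter_succ]
    -- the fine bonds of the average over `b'` have endpoints in `B(b'₋) ∪ B(b'₊)`
    have ih := bondAvgIter_eq_zero_of_vanish n (by omega) {w : Site P n | blockOf w ∈ S} A
      (fun b h1 h2 => hA b h1 h2)
    unfold bondAvg
    rw [Finset.sum_eq_zero fun r _ => ?_, smul_zero]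
    unfold segSum
    refine Finset.sum_eq_zero fun t htL => ?_
    have htL' := Finset.mem_range.mp htL
    have hr := (r b'.dir).isLt
    have hL := P.hL.2
    have htgt : b'.tgt = b'.src.shift b'.dir := rfl
    -- block of the `s`-th site of the contour, `s ≤ L`: `b'₋` or `b'₊`
    have hsite : ∀ s : ℕ, s ≤ P.L → blockOf (runSite (Site.blockSite b'.src r) b'.dir s) ∈ S := by
      intro s hs'
      by_cases hlt : (r b'.dir : ℕ) + s < P.L
      · rw [blockOf_runSite_blockSite_of_lt hn b'.src r b'.dir hlt]; exact hs
      · push Not at hlt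
        rw [blockOf_runSite_blockSite_of_ge hn b'.src r b'.dir hlt (by omega), ← htgt]; exact ht
    apply ih
    · exact hsite t htL'.le
    · show blockOf ((runSite (Site.blockSite b'.src r) b'.dir t).shift b'.dir) ∈ S
      rw [← runSite_succ]
      exact hsite (t + 1) (by omega)

/-- `Q′(A(Γ_{y,·}))(y) = 0` when `A` vanishes on the interior bonds of `B(y)` (every staircase `Γ_{y,x′}`, `x′ ∈ B(y)`, is interior).
[cite: BalabanImbrieJaffe1985, (5.1.11) p.315] -/
theorem blockMean_eq_zero_of_interior {j : ℕ} (hj : j + 1 ≤ P.m + P.K) {A : VecField P j V} (y : Site P (j + 1))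
    (hA : ∀ b : PBond P j, blockOf b.src = y → blockOf b.tgt = y → A b = 0) : blockMean A y = 0 := by
  unfold blockMean siteAvg
  rw [Finset.sum_eq_zero fun r _ => ?_, smul_zero]
  show contour A (Site.blockSite y r) = 0
  unfold contour
  rw [Site.blockOf_blockSite hj]
  exact stairSum_eq_zero_of_interior hj y hA r

/-- The bracket of (5.1.12) at `z` vanishes when `A` vanishes on the interior bonds of `B(z₊)`.
[cite: BalabanImbrieJaffe1985, (5.1.12) p.315] -/
theorem fluct_eq_zero_of_interior {j : ℕ} (hj : j + 1 ≤ P.m + P.K) {A : VecField P j V} (z : Site P j)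
    (hA : ∀ b : PBond P j, blockOf b.src = blockOf z → blockOf b.tgt = blockOf z → A b = 0) : fluct A z = 0 := by
  obtain ⟨r, hr⟩ := exists_blockSite_eq hj z
  unfold fluct contour
  rw [blockMean_eq_zero_of_interior hj (blockOf z) hA, sub_zero]
  have h := stairSum_eq_zero_of_interior hj (blockOf z) hA r
  rwa [hr] at h

/-- **LOCALITY of `λ(A)`**: if the η-lattice bond field `A` vanishes on every bond whose two endpoints lie in the unit block `B^k(y)`
(`blk k (b₋) = blk k (b₊) = y`), then `λ(A)(x) = 0` for every `x ∈ B^k(y)` — by (5.1.13): the `j`-th term reads `Q_jA` along the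
staircases `Γ_{x_{j+1},x′}`, `x′ ∈ B(x_{j+1})`, whose bonds have both endpoints in `B(x_{j+1}) ⊂ B^k(x_k)`, and there `Q_jA = 0` by
`bondAvgIter_eq_zero_of_vanish` (standing range `k ≤ m + K`; any lattice factor `c`). [cite: BalabanImbrieJaffe1985, (7.2.4) p.326] -/
theorem lamOf_eq_zero_of_vanish (c : ℝ) :
    ∀ (k : ℕ), k ≤ P.m + P.K → ∀ (y : Site P k) (A : VecField P 0 V),
      (∀ b : PBond P 0, blk k b.src = y → blk k b.tgt = y → A b = 0) → ∀ x : Site P 0, blk k x = y → lamOf c k A x = 0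
  | 0, _, _, _, _, _, _ => rfl
  | k + 1, hk, y, A, hA, x, hx => by
    rw [lamOf_succ, Pi.sub_apply, Pi.smul_apply, pull_apply]
    -- the first `k` scales: locality at scale `k` inside the smaller block `B^k(x_k) ⊂ B^{k+1}(y)`
    have h1 : lamOf c k A x = 0 :=
      lamOf_eq_zero_of_vanish c k (by omega) (blk k x) A
        (fun b hs ht => hA b (by rw [blk_succ, hs, ← blk_succ, hx]) (by rw [blk_succ, ht, ← blk_succ, hx])) x rfl
    -- the top scale: `Q_kA` vanishes on the bonds inside `B(y)`, so the bracket at `x_k` vanishes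
    have hQ : ∀ b' : PBond P k, blockOf b'.src = blockOf (blk k x) → blockOf b'.tgt = blockOf (blk k x) →
        bondAvgIter k A b' = 0 := by
      intro b' hs ht
      refine bondAvgIter_eq_zero_of_vanish k (by omega) {w : Site P k | blockOf w = y} A (fun b h1 h2 => hA b h1 h2) b' ?_ ?_
      · show blockOf b'.src = y
        rw [hs, ← blk_succ, hx]
      · show blockOf b'.tgt = y
        rw [ht, ← blk_succ, hx]
    rw [h1, fluct_eq_zero_of_interior hk (blk k x) hQ, smul_zero, sub_zero]

/-- **`λ(A)(x)` depends on `A` only through its values on the bonds of the unit block `B^k(x_k)`**: two fields agreeing there have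
the same `λ(·)(x)` (linearity + `lamOf_eq_zero_of_vanish`). [cite: BalabanImbrieJaffe1985, (7.2.4) p.326] -/
theorem lamOf_congr_tower {k : ℕ} (hk : k ≤ P.m + P.K) (c : ℝ) {A B : VecField P 0 V} (x : Site P 0)
    (h : ∀ b : PBond P 0, blk k b.src = blk k x → blk k b.tgt = blk k x → A b = B b) : lamOf c k A x = lamOf c k B x := by
  have hsub : lamOf c k (A - B) x = 0 :=
    lamOf_eq_zero_of_vanish c k hk (blk k x) (A - B) (fun b hs ht => by rw [Pi.sub_apply, h b hs ht, sub_self]) x rfl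
  rw [lamOf_sub, Pi.sub_apply] at hsub
  exact sub_eq_zero.mp hsub

end Locality

end Literature.MathematicalPhysics.QuantumFieldTheory.BalabanImbrieJaffe1984to88.BIJ85GaugeFnBound513
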